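import Mathlib
import Literature.MathematicalPhysics.QuantumFieldTheory.Balaban1983to89.Beta.BetaContinuityVolume

/-!
# `Balaban1983to89.Beta.LocalizedVolumeRate` — «This limit exists by the localized representation (1.7)» as a kernel
# lemma: STABILISATION of the small-domain terms of a localized representation + volume-uniform exponential tails ⇒ the
# torus kernels converge to the `ℤ^d` kernel at an EXPLICIT exponential volume rate (pv04's `VolumeRate`); hence (1.21)
# exists (with uniqueness and rate), (5.10)-type decay comes for free, and the β sub-cell's history-uniform rate (VR-u)
# and finite-volume continuity (C-fin) for the remainder kernel `Π¹` follow from ONE parametrised localized family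

T. Bałaban, *Renormalization group approach to lattice gauge field theories. I. Generation of effective actions in a
small field approximation and a coupling constant renormalization in four dimensions*, Commun. Math. Phys. **109**,
249–301 (1987) [Balaban1987RG1] (cell paper B12; PDF page = journal page − 248; PDF held:
`paper:balaban1987-cmp109-rg-i-small-field`).  Every sentence quoted below was read by this seat on the page renders
`HOME/b2b-balaban-ref1/pages/1987-cmp109-rg-I-small-field/1987-cmp109-rg-I-small-field-p013-x2.png` (p. 261) and
`…-p016-x2.png` (p. 264), read as images, not from an OCR layer.
* p. 261 [PDF 13], **(1.7)** and the sentence after it: *"We assume that it has the representation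
  E^{(j)}(g_{j−1}, U_j) = Σ_{X∈D_j} E^{(j)}(X, g_{j−1}, U_j).  (1.7)  Again, the term corresponding to a domain X depends
  on U_j restricted to X."*
* p. 264 [PDF 16], after **(1.21)**: *"Now we take a limit of these functions as T^{(j+1)} ↗ Z^d. This limit exists by
  the localized representation (1.7)."*

WHAT THIS MODULE IS.  The existence of the limit (1.21) is ASSERTED in print with the one-clause justification quoted
above and no proof (cell GAPS G-adv2-2; census leaf (g) of `Beta.RemainderChain.Chain.leaves`); the sibling
`B12Limit51` supplies SUBSEQUENTIAL existence from volume-uniform bounds and leaves uniqueness by reference; the volume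
lineage's rate calculus (`Beta/VolumeImages`, `VolumePeriodise`, `VolumeConvolution`, `VolumeAffine`) is the METHOD OF
IMAGES and reaches kernels that ARE periodisations — the one-loop kernels — but not the remainder kernel `Π¹` of a
non-Gaussian functional.  This module types the mechanism print names, in the abstract:
* §1 `abs_tsum_sub_tsum_le_of_stable` — the STABILISATION LEMMA: two absolutely summable term families (torus side /
  `ℤ^d` side) whose terms of size `< r` correspond bijectively with equal values differ by at most the two tails of
  size `≥ r` [folklore; the pressure version of the same bookkeeping is e.g. Friedli–Velenik, *Statistical Mechanics
  of Lattice Systems* (2017) §5.7.1, (5.29)–(5.32) p. 250: clusters containing a fixed vertex form an absolutely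
  convergent series, finite volume = infinite volume minus boundary clusters];
  `abs_le_tail`, `abs_tsum_le_decay` — (1.18)-type domination `|term(X)| ≤ A e^{−dec·size(X)}`, the geometric support
  clause "a term contributes to the entry at separation `y` only if `|y|₁ ≤ M·size`" and a tree leaf
  `Σ' e^{−(dec/2)·size} ≤ K` give tails `≤ A K e^{−(dec/4) r} e^{−(dec/(4M))|y|₁}` and the (5.10)-shape bound
  `A K e^{−(dec/(2M))|y|₁}`.
* §2 `LocalizedRep side P A dec M K r` — the DATA of a localized representation of ONE torus kernel family `P t`
  (sides `side t`): term families on each torus and on `ℤ^d`, the three estimates above with VOLUME-UNIFORM constants,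
  and the stabilisation equivalence of the domains of size `< r t`; `LocalizedRep.volumeRate` — THE THEOREM:
  `VolumeRate side P locLimit (t ↦ 2AK·e^{−(dec/4)·r t}) (dec/(4M))` towards the `ℤ^d` kernel `locLimit` (the sum of
  the `ℤ^d` terms); with `r t → ∞`, `side t → ∞`: `isInfiniteVolumeLimit` (pv25's (1.21) predicate — EXISTENCE),
  `eq_locLimit` (UNIQUENESS: any pointwise limit is `locLimit`), `volumeRate_of_isLimit`; and for free
  `decay_locLimit` / `uniformDecay` ((5.10)-shape decay of the limit and of the tori, constants `A K`, `dec/(2M)`).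
* §3 `LocalizedFamily side s P A dec M K r` — the same data for a kernel family PARAMETRISED by `v ∈ s` (the history
  `(g_0,…,g_k)` on a box) with `v`-UNIFORM constants and TERMWISE CONTINUITY in `v` of the finite-volume terms
  ((C-term)); theorems: `continuousOn_torus` = (C-fin) by the Weierstrass M-test, `volumeRate` = (VR-u),
  `continuousOn_locLimit` = (C-pt) for the limit kernel (via `BetaContinuityVolume.continuousOn_lim_of_volumeRate`).
* §4–§5 consumers in the β sub-cell: `cpt_of_localizedFamily`, `betaContH_of_chain_localized` (+ the primed variant
  identifying the chain's `P1` through pv25's limit predicate instead of an equation), and the END-STATEMENT-grade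
  `thm2Printed_of_remainderChain_loc` / `endpointExistence_of_remainderChain_loc`: the hypotheses (C-pt) / (C-fin) +
  (VR-u) of `BetaContinuity` / `BetaContinuityVolume` are replaced by ONE localized family per scale.
* §6 non-vacuity of the structure shapes (degenerate witness: empty index types, zero kernels).

LOCATED INPUTS (hypotheses = structure fields, used only to the left of `→`; NOT facts, NOT printed as stated):
(LOC) the cross-volume STABILISATION clause `stable` — the cell's READING of "localized representation": the term of a
domain that does not wrap around the torus is the same functional as the term of the unwrapped domain of `ℤ^d`, so that
on PINNED domains (containing the base point, one per translation class) of size `< r t` (with `r t` of order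
`side t / M`) torus terms and `ℤ^d` terms correspond one to one; print
states locality in the FIELD variable (p. 261) and invokes it for the limit (p. 264) without spelling out the cross-volume
identity — labelled here as a reading, G-adv2-2 stays the locus; (1.18)-type bounds with volume-free constants and the
tree leaf ([II] (1.26) p. 8 type, `B13.TreeLeaf`) — as in `B12Decay510`, whose `hlim` hypothesis this module's
`isInfiniteVolumeLimit` is designed to feed once its geometry is instantiated; (C-term) termwise continuity in the
history of the finite-volume terms (§3 only).  Nothing here identifies `A` with `O(1)E₀` or `dec` with `κ` of (1.18):
that identification is the instantiator's located input (GAPS G-B13-07…11 for the activity).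

HONEST FRAMING.  Value = kernel bookkeeping: one sentence ASSERTED in print ("This limit exists by the localized
representation (1.7)") becomes a lemma modulo a precisely typed locality clause, and two located inputs of the β
sub-cell ((VR-u), (C-fin)/(C-pt)) are folded into one of printed TYPE plus (C-term).  It discharges nothing about
Bałaban's actual kernels, claims no sign of any β-coefficient, and leaves the sub-cell's wall ((AF-0)/(M2), BETA-SPEC
§6–§7) untouched.  The β sub-cell as a whole would, if completed, make the cell's UV-stability bookkeeping unconditional
in its flow input — a constructive-QFT statement that is NOT the continuum limit, NOT a mass gap, NOT the Clay problem.
(HONEST FRAMING of the cell, verbatim: discharging `BetaPertH` makes Bałaban's UV stability UNCONDITIONAL — a real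
constructive-QFT result; it is NOT the continuum limit and NOT the Clay problem.  Gloss 1, BETA-SPEC v1.8d l. 17–22, GAPS
G-ref2-14 (a) / G-ref2-20 (a) / G-ref2-23 (a) / G-ref2-24 (a), verbatim: «UNCONDITIONAL» in [Balaban1989LargeFieldII] (B16)
p. 355's interval-hypothesis sense ONLY (`FlowStepRuns.p355Unconditional_of_partialSums` keeps `hnodes`); the located
leaves G-adv3-2 (left inequality of (0.1)/(2.50), d = 4), G-adv3-1 (U2 transfer of B14 Cor. 3's lower bound) and
`SecondExpLeaf` REMAIN.  Gloss 2, BETA-SPEC v1.9e l. 23–25, beta-ref C-beta-78, BINDING: «UNCONDITIONAL» =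
`Beta.Assembly.EventualForm`-unconditional — the END statement with the interval hypothesis removed, (0.31) in DEFECTED
form on all lattices (`PrefixAbsorption.thm2Defected_of_eventualForm`), admissible couplings shrunk to g ≤ g⋆; NOT «B12
Theorem 2 as printed» (`eventualForm_not_thm2Printed`, RULING (R6)); never the continuum limit / mass gap / Clay.)
NOT summit progress.  Zero `sorry`; axioms standard.

v1.1 (docstring + one helper proof, declarations and statements byte-unchanged; review notes of p179327): the index
types are documented as PINNED domains (reviewer item 2), and `abs_tsum_le_tsum_of_abs_le` is proved from Mathlib's
`tsum_of_norm_bounded` (item 1).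
v1.2 (DOCSTRING ONLY, every declaration byte-unchanged; GAPS G-pv10-9 R1 by pv10-g4, CONCUR C-beta-62 by beta-ref-g12,
adopted by the an4 lineage gen 3): the `LocalizedRep` docstring now says (i) why pinning is lossless (print ASSUMES
translation invariance of every term, p. 263, and (1.21)), and (ii) which TERM FAMILY the exact-support fields index —
re-localized, exactly supported pieces of the (1.20)-derivatives of the (1.7)-terms (the derivatives act through `H_j`,
(4.2) p. 281, and have exponential tails outside `X`, p. 282); the two-sided tail form of the same terms is the sibling
`B12Decay510.KernelBound`.  Kernel content, statements and the XREAD verdict C-pv10-25 (boundary clean) unaffected.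
v1.2.1 (DOCFIX, header only, every declaration byte-unchanged; ref2 R33 / GAPS G-ref2-24 (a) «NEW BARE LOCI …
`Beta/LocalizedVolumeRate` v1.2 l. 71–72», an4 lineage gen 4): the cell's HONEST FRAMING sentence with glosses 1 AND 2 is
now carried verbatim above (model `Beta/HomogSmoothTransverse` l. 8–14); no declaration changed.
-/

namespace Literature.MathematicalPhysics.QuantumFieldTheory.Balaban1983to89.Beta.LocalizedVolumeRate

open Literature.MathematicalPhysics.QuantumFieldTheory.Balaban1983to89
open Literature.MathematicalPhysics.QuantumFieldTheory.Balaban1983to89.B12Sec2to5 (l1 l1_nonneg Decay510)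
open Literature.MathematicalPhysics.QuantumFieldTheory.Balaban1983to89.FlowStep
open Literature.MathematicalPhysics.QuantumFieldTheory.Balaban1983to89.DagBinding
open Literature.MathematicalPhysics.QuantumFieldTheory.Balaban1983to89.FlowStepRuns
open Literature.MathematicalPhysics.QuantumFieldTheory.Balaban1983to89.Beta.RemainderChain
open Literature.MathematicalPhysics.QuantumFieldTheory.Balaban1983to89.Beta.BetaContinuity
open Literature.MathematicalPhysics.QuantumFieldTheory.Balaban1983to89.Beta.BetaContinuityVolume
open _root_.Filter
open scoped _root_.Topology

noncomputable section

/-! ## 1. Abstract tail bookkeeping -/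

/-- `|∑' f| ≤ ∑' g` as soon as `|f i| ≤ g i` termwise and `g` is summable (the real-valued specialisation of Mathlib's
`tsum_of_norm_bounded`, kept under a local name for the callers below). [folklore] -/
theorem abs_tsum_le_tsum_of_abs_le {ι : Type*} {f g : ι → ℝ} (hg : Summable g) (h : ∀ i, |f i| ≤ g i) :
    |∑' i, f i| ≤ ∑' i, g i := by
  rw [← Real.norm_eq_abs]
  exact tsum_of_norm_bounded hg.hasSum fun i => by simpa only [Real.norm_eq_abs] using h i

/-- **STABILISATION LEMMA (abstract).**  Two absolutely summable real families `a` (index type `ι`, "domains of `ℤ^d`")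
and `b` (index type `κ`, "domains of a torus"); the "small" parts `p ⊆ ι`, `q ⊆ κ` correspond by an equivalence
carrying `b` to `a`; outside the small parts the terms are dominated by summable nonnegative `g`, `h`.  Then the two
sums differ by at most the two tails: `|Σ' b − Σ' a| ≤ Σ' g + Σ' h`. [folklore] -/
theorem abs_tsum_sub_tsum_le_of_stable {ι κ : Type*} {a : ι → ℝ} {b : κ → ℝ} (ha : Summable a) (hb : Summable b)
    (p : Set ι) (q : Set κ) (φ : p ≃ q) (hφ : ∀ Y : p, b (φ Y) = a Y)
    {g : ι → ℝ} {h : κ → ℝ} (hg : Summable g) (hh : Summable h) (hg0 : ∀ Y, 0 ≤ g Y) (hh0 : ∀ X, 0 ≤ h X)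
    (hga : ∀ Y, Y ∉ p → |a Y| ≤ g Y) (hhb : ∀ X, X ∉ q → |b X| ≤ h X) :
    |∑' X, b X - ∑' Y, a Y| ≤ ∑' Y, g Y + ∑' X, h X := by
  have sa := ha.tsum_subtype_add_tsum_subtype_compl p
  have sb := hb.tsum_subtype_add_tsum_subtype_compl q
  have hsmall : ∑' X : q, b X = ∑' Y : p, a Y := by
    rw [← Equiv.tsum_eq φ (fun X : q => b X)]
    exact tsum_congr hφ
  have hgs : Summable (fun Y : ↥pᶜ => g Y) := hg.subtype _
  have hhs : Summable (fun X : ↥qᶜ => h X) := hh.subtype _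
  have hla : |∑' Y : ↥pᶜ, a Y| ≤ ∑' Y, g Y :=
    (abs_tsum_le_tsum_of_abs_le hgs fun Y => hga Y Y.2).trans (Summable.tsum_subtype_le g _ hg0 hg)
  have hlb : |∑' X : ↥qᶜ, b X| ≤ ∑' X, h X :=
    (abs_tsum_le_tsum_of_abs_le hhs fun X => hhb X X.2).trans (Summable.tsum_subtype_le h _ hh0 hh)
  have hdiff : ∑' X, b X - ∑' Y, a Y = ∑' X : ↥qᶜ, b X - ∑' Y : ↥pᶜ, a Y := by
    rw [← sa, ← sb, hsmall]; ring
  rw [hdiff]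
  calc |∑' X : ↥qᶜ, b X - ∑' Y : ↥pᶜ, a Y| ≤ |∑' X : ↥qᶜ, b X| + |∑' Y : ↥pᶜ, a Y| := abs_sub _ _
    _ ≤ ∑' X, h X + ∑' Y, g Y := add_le_add hlb hla
    _ = ∑' Y, g Y + ∑' X, h X := add_comm _ _

/-- **SUMMABILITY from (1.18)-type domination**: `|f| ≤ A e^{−dec·size}` with `size ≥ 0`, `dec > 0`, `A ≥ 0`, and the
tree leaf `Σ' e^{−(dec/2)·size}` summable ⇒ `f` summable. [folklore] -/
theorem summable_of_bound {ι : Type*} {f : ι → ℝ} {sz : ι → ℝ} {A dec : ℝ} (hA : 0 ≤ A) (hdec : 0 < dec)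
    (hsz : ∀ Y, 0 ≤ sz Y) (hbound : ∀ Y, |f Y| ≤ A * Real.exp (-(dec * sz Y)))
    (hsum : Summable (fun Y => Real.exp (-(dec / 2 * sz Y)))) : Summable f := by
  refine Summable.of_norm_bounded (hsum.mul_left A) fun Y => ?_
  rw [Real.norm_eq_abs]
  refine (hbound Y).trans (mul_le_mul_of_nonneg_left (Real.exp_le_exp.mpr ?_) hA)
  nlinarith [mul_nonneg hdec.le (hsz Y)]

/-- **TAIL ESTIMATE beyond size `r`.**  A term dominated by `A e^{−dec·size}` and vanishing unless `s ≤ M·size`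
(geometry: a domain contributing at separation `s = |y|₁` has `M·size ≥ s`) satisfies, when its size is `≥ r`,
`|f| ≤ A e^{−(dec/4) r} e^{−(dec/(4M)) s} · e^{−(dec/2)·size}` — half of the decay rate pays for the tree leaf, a
quarter for the volume rate, a quarter for the separation. [folklore] -/
theorem abs_le_tail {ι : Type*} {f : ι → ℝ} {sz : ι → ℝ} {A dec M s r : ℝ} (hA : 0 ≤ A) (hdec : 0 < dec)
    (hM : 0 < M) (hbound : ∀ Y, |f Y| ≤ A * Real.exp (-(dec * sz Y))) (hsupp : ∀ Y, f Y ≠ 0 → s ≤ M * sz Y)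
    {Y : ι} (hY : r ≤ sz Y) :
    |f Y| ≤ A * Real.exp (-(dec / 4 * r)) * Real.exp (-(dec / (4 * M)) * s) * Real.exp (-(dec / 2 * sz Y)) := by
  by_cases h0 : f Y = 0
  · rw [h0, abs_zero]; positivity
  · have hs : s ≤ M * sz Y := hsupp Y h0
    have h2 : dec / (4 * M) * s ≤ dec / 4 * sz Y :=
      calc dec / (4 * M) * s ≤ dec / (4 * M) * (M * sz Y) := mul_le_mul_of_nonneg_left hs (by positivity)
        _ = dec / 4 * sz Y := by field_simp
    have h1 : dec / 4 * r ≤ dec / 4 * sz Y := mul_le_mul_of_nonneg_left hY (by positivity)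
    refine (hbound Y).trans ?_
    rw [mul_assoc, mul_assoc, ← Real.exp_add, ← Real.exp_add]
    refine mul_le_mul_of_nonneg_left (Real.exp_le_exp.mpr ?_) hA
    linarith

/-- **(5.10)-SHAPE DECAY from a localized representation** (the abstract skeleton of what `B12Decay510` proves with the
actual geometry): a summable-term family dominated by `A e^{−dec·size}`, vanishing unless `s ≤ M·size`, with tree leaf
`Σ' e^{−(dec/2)·size} ≤ K`, has `|Σ' f| ≤ A K e^{−(dec/(2M)) s}`. [folklore] -/
theorem abs_tsum_le_decay {ι : Type*} {f : ι → ℝ} {sz : ι → ℝ} {A dec M K s : ℝ} (hA : 0 ≤ A) (hdec : 0 < dec)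
    (hM : 0 < M) (hbound : ∀ Y, |f Y| ≤ A * Real.exp (-(dec * sz Y)))
    (hsupp : ∀ Y, f Y ≠ 0 → s ≤ M * sz Y) (hsum : Summable (fun Y => Real.exp (-(dec / 2 * sz Y))))
    (htree : ∑' Y, Real.exp (-(dec / 2 * sz Y)) ≤ K) :
    |∑' Y, f Y| ≤ A * K * Real.exp (-(dec / (2 * M)) * s) := by
  set E := A * Real.exp (-(dec / (2 * M)) * s) with hE
  have hE0 : 0 ≤ E := by positivity
  have hterm : ∀ Y, |f Y| ≤ E * Real.exp (-(dec / 2 * sz Y)) := by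
    intro Y
    by_cases h0 : f Y = 0
    · rw [h0, abs_zero]; positivity
    · have hs : s ≤ M * sz Y := hsupp Y h0
      have h2 : dec / (2 * M) * s ≤ dec / 2 * sz Y :=
        calc dec / (2 * M) * s ≤ dec / (2 * M) * (M * sz Y) := mul_le_mul_of_nonneg_left hs (by positivity)
          _ = dec / 2 * sz Y := by field_simp
      refine (hbound Y).trans ?_
      rw [hE, mul_assoc, ← Real.exp_add]
      refine mul_le_mul_of_nonneg_left (Real.exp_le_exp.mpr ?_) hA
      linarith
  calc |∑' Y, f Y| ≤ ∑' Y, E * Real.exp (-(dec / 2 * sz Y)) := abs_tsum_le_tsum_of_abs_le (hsum.mul_left E) hterm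
    _ = E * ∑' Y, Real.exp (-(dec / 2 * sz Y)) := tsum_mul_left
    _ ≤ E * K := mul_le_mul_of_nonneg_left htree hE0
    _ = A * K * Real.exp (-(dec / (2 * M)) * s) := by rw [hE]; ring

/-- The volume-rate moduli `2AK·e^{−(dec/4)·r t}` tend to `0` when the stabilisation radii `r t → ∞`. [folklore] -/
theorem tendsto_rate {A K dec : ℝ} {r : ℕ → ℝ} (hdec : 0 < dec) (hr : Tendsto r atTop atTop) :
    Tendsto (fun t => 2 * A * K * Real.exp (-(dec / 4 * r t))) atTop (𝓝 0) := by
  have h1 : Tendsto (fun t => dec / 4 * r t) atTop atTop := hr.const_mul_atTop (by positivity)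
  have h2 : Tendsto (fun t => Real.exp (-(dec / 4 * r t))) atTop (𝓝 0) :=
    Real.tendsto_exp_atBot.comp (tendsto_neg_atTop_atBot.comp h1)
  simpa using h2.const_mul (2 * A * K)

/-! ## 2. Localized representation of ONE torus kernel family ⇒ volume rate, existence and uniqueness of (1.21) -/

/-- **LOCALIZED REPRESENTATION DATA for a torus kernel family** `P t : Fin d → Fin d → Site d (side t) → ℝ` (a located
input SHAPE; its fields are hypotheses, nothing is asserted about Bałaban's kernels).  `ι` indexes the PINNED domains
of `ℤ^d` — the domains containing the base point (the first plaquette of the entry), ONE per translation class, in the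
style of "clusters containing a fixed vertex" (Friedli–Velenik §5.7.1) — with sizes `sz` and terms `a μ ν y` (the
contribution of the pinned domain to the `ℤ^d` kernel entry `(μ,ν)` at separation `y`; translation invariance is what
makes pinning lossless — print ASSUMES the Euclidean, in particular translation, invariance of every term: p. 263
*"We assume that the action (1.3) is invariant with respect to the transformations of the lattice T^{(k)}"*, and (1.21)).
v1.2 (G-pv10-9 R1, pv10-g4; CONCUR C-beta-62): the TERMS meant here are RE-LOCALIZED, EXACTLY SUPPORTED PIECES of the
(1.20)-derivatives of the (1.7)-terms — `B` enters `E^{(j+1)}(X, ·)` through the minimizer `U_{j+1}(exp iB)`, i.e.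
through `H_j` ((4.2) p. 281), whose derivatives have exponential TAILS outside `X` (p. 282: *"if one of the functions
B_i is localized outside the domain X, then we have the additional exponential factor exp(−δ₀dist^{(ξ)}(X, supp B_i))"*),
so an instantiation by Bałaban's (4.37)/(1.20) X-terms first re-localizes each X-term into pieces indexed by (X, tree
graph / random walk of [15] Sect. G) with size `d_j(X) + length/M` and bound `A e^{−dec·size}` (the instantiator's
located input, same family as GAPS G-B13-07…11 / G-adv2-2); the two-sided TAIL form of the same terms is the sibling
`B12Decay510.KernelBound`.  The exact-support fields `supp_inf`/`supp_torus` below are stated for the re-localized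
pieces; nothing in the kernel content depends on which reading is instantiated.  NOT all translates: with every translate indexed separately the small part `{Y | sz Y < r t}`
would be infinite and the stabilisation field `stable` below (an equivalence with the FINITELY many small pinned domains
of a finite torus) unsatisfiable — an instantiator must pin.  Likewise `κ t` indexes the pinned domains of the torus `t`
with sizes `szt t` and terms `b t μ ν x` summing to `P t μ ν x` (`hasSum_torus`, the representation (1.7)
differentiated twice, (1.20)); (1.18)-type domination with
VOLUME-FREE `A`, `dec` (`bound_inf`, `bound_torus`); the geometric support clause with constant `M` (`supp_inf`,
`supp_torus`: a term is nonzero at separation `y` only if `|y|₁ ≤ M·size`); the tree leaf with VOLUME-FREE `K`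
(`summable_*`, `tree_*`, [II] (1.26) type); and (LOC) `stable`: on each torus the domains of size `< r t` correspond
one to one to the `ℤ^d` domains of size `< r t`, with equal terms at the window representative `windowMap x` of the
separation.  [cite: Balaban1987RG1, (1.7) p.261, (1.21) p.264, p.263 (Euclidean invariance), (4.2) p.281, p.282] -/
structure LocalizedRep {d : ℕ} (side : ℕ → ℕ) [∀ t, NeZero (side t)]
    (P : (t : ℕ) → Fin d → Fin d → Site d (side t) → ℝ) (A dec M K : ℝ) (r : ℕ → ℝ) : Type 1 where
  /-- index of the PINNED `ℤ^d`-side domains (containing the base point; one per translation class) -/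
  ι : Type
  /-- index of the pinned domains of the torus `t` -/
  κ : ℕ → Type
  /-- sizes of `ℤ^d` domains (`d_j(X)` of (1.18), in the units where `M` below enters) -/
  sz : ι → ℝ
  /-- sizes of torus domains -/
  szt : (t : ℕ) → κ t → ℝ
  /-- `ℤ^d` terms: entry `(μ,ν)` at separation `y` of the term of domain `Y` -/
  a : Fin d → Fin d → (Fin d → ℤ) → ι → ℝ
  /-- torus terms: entry `(μ,ν)` at separation `x ∈ (ℤ/side t)^d` of the term of domain `X` -/
  b : (t : ℕ) → Fin d → Fin d → Site d (side t) → κ t → ℝ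
  A_nonneg : 0 ≤ A
  dec_pos : 0 < dec
  M_pos : 0 < M
  sz_nonneg : ∀ Y, 0 ≤ sz Y
  szt_nonneg : ∀ t X, 0 ≤ szt t X
  /-- the torus kernel IS the sum of its terms ((1.7) differentiated, (1.20)) -/
  hasSum_torus : ∀ t μ ν x, HasSum (fun X => b t μ ν x X) (P t μ ν x)
  /-- (1.18)-type domination, volume-free constants -/
  bound_inf : ∀ μ ν y Y, |a μ ν y Y| ≤ A * Real.exp (-(dec * sz Y))
  bound_torus : ∀ t μ ν x X, |b t μ ν x X| ≤ A * Real.exp (-(dec * szt t X))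
  /-- geometric support clause: a domain containing both links has `M·size ≥ |separation|₁` -/
  supp_inf : ∀ μ ν y Y, a μ ν y Y ≠ 0 → l1 y ≤ M * sz Y
  supp_torus : ∀ t μ ν x X, b t μ ν x X ≠ 0 → l1 (windowMap d (side t) x) ≤ M * szt t X
  /-- tree leaf ([II] (1.26) type), volume-free constant -/
  summable_inf : Summable (fun Y => Real.exp (-(dec / 2 * sz Y)))
  tree_inf : ∑' Y, Real.exp (-(dec / 2 * sz Y)) ≤ K
  summable_torus : ∀ t, Summable (fun X => Real.exp (-(dec / 2 * szt t X)))
  tree_torus : ∀ t, ∑' X, Real.exp (-(dec / 2 * szt t X)) ≤ K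
  /-- (LOC) STABILISATION: small torus domains ≃ small `ℤ^d` domains, with equal terms (located reading of p. 264) -/
  stable : ∀ t, ∃ φ : ↥{Y | sz Y < r t} ≃ ↥{X | szt t X < r t},
    ∀ (μ ν : Fin d) (x : Site d (side t)) (Y : ↥{Y | sz Y < r t}), b t μ ν x (φ Y) = a μ ν (windowMap d (side t) x) Y

/-- Prop form of `LocalizedRep` ("the torus family ADMITS a localized representation with these constants").
[cite: Balaban1987RG1, (1.7) p.261 and (1.21) p.264] -/
def HasLocalizedRep {d : ℕ} (side : ℕ → ℕ) [∀ t, NeZero (side t)]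
    (P : (t : ℕ) → Fin d → Fin d → Site d (side t) → ℝ) (A dec M K : ℝ) (r : ℕ → ℝ) : Prop :=
  Nonempty (LocalizedRep side P A dec M K r)

section One

variable {d : ℕ} {side : ℕ → ℕ} [∀ t, NeZero (side t)] {P : (t : ℕ) → Fin d → Fin d → Site d (side t) → ℝ}
  {A dec M K : ℝ} {r : ℕ → ℝ}

/-- The `ℤ^d` kernel of a localized representation: the sum of the `ℤ^d` terms (the candidate limit (1.21)).
[cite: Balaban1987RG1, (1.21) p.264] -/
def LocalizedRep.locLimit (R : LocalizedRep side P A dec M K r) : B12Beta.Kernel d :=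
  fun μ ν y => ∑' Y, R.a μ ν y Y

/-- The `ℤ^d` term family at every separation is summable. [folklore] -/
theorem LocalizedRep.summable_a (R : LocalizedRep side P A dec M K r) (μ ν : Fin d) (y : Fin d → ℤ) :
    Summable (fun Y => R.a μ ν y Y) :=
  summable_of_bound R.A_nonneg R.dec_pos R.sz_nonneg (R.bound_inf μ ν y) R.summable_inf

/-- The torus term family is summable. [folklore] -/
theorem LocalizedRep.summable_b (R : LocalizedRep side P A dec M K r) (t : ℕ) (μ ν : Fin d) (x : Site d (side t)) :
    Summable (fun X => R.b t μ ν x X) :=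
  summable_of_bound R.A_nonneg R.dec_pos (R.szt_nonneg t) (R.bound_torus t μ ν x) (R.summable_torus t)

/-- **THE VOLUME RATE from a localized representation** ("This limit exists by the localized representation (1.7)",
quantified): on the window of the torus of side `side t`,
`|P t μ ν x − locLimit μ ν (windowMap x)| ≤ 2AK·e^{−(dec/4)·r t} · e^{−(dec/(4M))·|windowMap x|₁}` — pv04's
`VolumeRate side P locLimit ρ δ` with the EXPLICIT moduli `ρ t = 2AK e^{−(dec/4) r t}` and `δ = dec/(4M)`.  Proof: the
small domains cancel by (LOC); both tails are bounded by `abs_le_tail` and the tree leaves.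
[cite: Balaban1987RG1, (1.21) p.264] -/
theorem LocalizedRep.volumeRate (R : LocalizedRep side P A dec M K r) :
    VolumeRate side P R.locLimit (fun t => 2 * A * K * Real.exp (-(dec / 4 * r t))) (dec / (4 * M)) := by
  intro t μ ν x
  obtain ⟨φ, hφ⟩ := R.stable t
  have hA := R.A_nonneg
  set E := A * Real.exp (-(dec / 4 * r t)) * Real.exp (-(dec / (4 * M)) * l1 (windowMap d (side t) x)) with hE
  have hE0 : 0 ≤ E := by positivity
  have key := abs_tsum_sub_tsum_le_of_stable (R.summable_a μ ν (windowMap d (side t) x)) (R.summable_b t μ ν x)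
    {Y | R.sz Y < r t} {X | R.szt t X < r t} φ (hφ μ ν x)
    (g := fun Y => E * Real.exp (-(dec / 2 * R.sz Y))) (h := fun X => E * Real.exp (-(dec / 2 * R.szt t X)))
    (R.summable_inf.mul_left E) ((R.summable_torus t).mul_left E) (fun Y => by positivity) (fun X => by positivity)
    (fun Y hY => by
      rw [hE]
      exact abs_le_tail R.A_nonneg R.dec_pos R.M_pos (R.bound_inf μ ν _) (R.supp_inf μ ν _)
        (not_lt.mp (by simpa using hY)))
    (fun X hX => by
      rw [hE]
      exact abs_le_tail R.A_nonneg R.dec_pos R.M_pos (R.bound_torus t μ ν x) (R.supp_torus t μ ν x)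
        (not_lt.mp (by simpa using hX)))
  rw [(R.hasSum_torus t μ ν x).tsum_eq, tsum_mul_left, tsum_mul_left] at key
  show |P t μ ν x - ∑' Y, R.a μ ν (windowMap d (side t) x) Y| ≤
    2 * A * K * Real.exp (-(dec / 4 * r t)) * Real.exp (-(dec / (4 * M)) * l1 (windowMap d (side t) x))
  refine key.trans ?_
  calc E * ∑' Y, Real.exp (-(dec / 2 * R.sz Y)) + E * ∑' X, Real.exp (-(dec / 2 * R.szt t X))
      ≤ E * K + E * K := add_le_add (mul_le_mul_of_nonneg_left R.tree_inf hE0)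
        (mul_le_mul_of_nonneg_left (R.tree_torus t) hE0)
    _ = 2 * A * K * Real.exp (-(dec / 4 * r t)) * Real.exp (-(dec / (4 * M)) * l1 (windowMap d (side t) x)) := by
        rw [hE]; ring

/-- **EXISTENCE of (1.21)**: with stabilisation radii `r t → ∞` along sides `side t → ∞`, the torus kernels converge
pointwise to `locLimit` in pv25's sense `IsInfiniteVolumeLimit` (through pv04's `VolumeRate.isInfiniteVolumeLimit`).
This is the kernel content of *"This limit exists by the localized representation (1.7)"* modulo (LOC).
[cite: Balaban1987RG1, (1.21) p.264] -/
theorem LocalizedRep.isInfiniteVolumeLimit (R : LocalizedRep side P A dec M K r) (hside : Tendsto side atTop atTop)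
    (hr : Tendsto r atTop atTop) : IsInfiniteVolumeLimit side P R.locLimit :=
  R.volumeRate.isInfiniteVolumeLimit (tendsto_rate R.dec_pos hr) hside

/-- **UNIQUENESS**: any pointwise infinite-volume limit of the torus kernels coincides with `locLimit` (limits in `ℝ`
are unique) — so a consumer holding its own limit kernel `Pinf` (e.g. the (1.21) field of a dictionary) may use every
statement below with `Pinf`. [folklore] -/
theorem LocalizedRep.eq_locLimit (R : LocalizedRep side P A dec M K r) (hside : Tendsto side atTop atTop)
    (hr : Tendsto r atTop atTop) {Pinf : B12Beta.Kernel d} (hlim : IsInfiniteVolumeLimit side P Pinf) :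
    Pinf = R.locLimit := by
  funext μ ν y
  exact tendsto_nhds_unique (hlim μ ν y) (R.isInfiniteVolumeLimit hside hr μ ν y)

/-- The volume rate towards ANY pointwise limit kernel `Pinf` of the torus family (by uniqueness).
[cite: Balaban1987RG1, (1.21) p.264] -/
theorem LocalizedRep.volumeRate_of_isLimit (R : LocalizedRep side P A dec M K r) (hside : Tendsto side atTop atTop)
    (hr : Tendsto r atTop atTop) {Pinf : B12Beta.Kernel d} (hlim : IsInfiniteVolumeLimit side P Pinf) :
    VolumeRate side P Pinf (fun t => 2 * A * K * Real.exp (-(dec / 4 * r t))) (dec / (4 * M)) := by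
  rw [R.eq_locLimit hside hr hlim]
  exact R.volumeRate

/-- **(5.10)-shape decay of the limit kernel for free**: `|locLimit μ ν y| ≤ A K e^{−(dec/(2M))|y|₁}`, i.e.
`Decay510 (locLimit μ ν) (A K) (dec/(2M))` (the abstract skeleton of `B12Decay510`; no claim about the printed
constants `O(1)E₀`, `δ₁`). [cite: Balaban1987RG1, (5.10) p.293] -/
theorem LocalizedRep.decay_locLimit (R : LocalizedRep side P A dec M K r) (μ ν : Fin d) :
    Decay510 (R.locLimit μ ν) (A * K) (dec / (2 * M)) :=
  fun y => abs_tsum_le_decay R.A_nonneg R.dec_pos R.M_pos (R.bound_inf μ ν y) (R.supp_inf μ ν y)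
    R.summable_inf R.tree_inf

/-- **Volume-uniform (5.10)-shape decay of the torus kernels for free**: pv25's `UniformDecay side P (A K) (dec/(2M))`.
[cite: Balaban1987RG1, (5.10) p.293] -/
theorem LocalizedRep.uniformDecay (R : LocalizedRep side P A dec M K r) : UniformDecay side P (A * K) (dec / (2 * M)) := by
  intro t μ ν x
  rw [← (R.hasSum_torus t μ ν x).tsum_eq]
  exact abs_tsum_le_decay R.A_nonneg R.dec_pos R.M_pos (R.bound_torus t μ ν x) (R.supp_torus t μ ν x)
    (R.summable_torus t) (R.tree_torus t)

end One

/-! ## 3. A localized family PARAMETRISED by the history: (C-fin), (VR-u) and (C-pt) from one structure -/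

/-- **LOCALIZED REPRESENTATION DATA for a PARAMETRISED torus kernel family** `P t v` (`v ∈ s`, e.g. the history
`(g_0,…,g_k)` in a box): the fields of `LocalizedRep` for every `v ∈ s` with the SAME index types, sizes, constants
`A, dec, M, K` and radii `r` (history-UNIFORM data), plus (C-term) `cont_term`: every finite-volume term is continuous in
`v` on `s`.  A located input SHAPE; nothing asserted. [cite: Balaban1987RG1, (1.7) p.261 and (1.21)–(1.22) p.264] -/
structure LocalizedFamily {d : ℕ} (side : ℕ → ℕ) [∀ t, NeZero (side t)] {V : Type} [TopologicalSpace V] (s : Set V)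
    (P : (t : ℕ) → V → Fin d → Fin d → Site d (side t) → ℝ) (A dec M K : ℝ) (r : ℕ → ℝ) : Type 1 where
  ι : Type
  κ : ℕ → Type
  sz : ι → ℝ
  szt : (t : ℕ) → κ t → ℝ
  a : V → Fin d → Fin d → (Fin d → ℤ) → ι → ℝ
  b : V → (t : ℕ) → Fin d → Fin d → Site d (side t) → κ t → ℝ
  A_nonneg : 0 ≤ A
  dec_pos : 0 < dec
  M_pos : 0 < M
  sz_nonneg : ∀ Y, 0 ≤ sz Y
  szt_nonneg : ∀ t X, 0 ≤ szt t X
  hasSum_torus : ∀ v ∈ s, ∀ t μ ν x, HasSum (fun X => b v t μ ν x X) (P t v μ ν x)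
  bound_inf : ∀ v ∈ s, ∀ μ ν y Y, |a v μ ν y Y| ≤ A * Real.exp (-(dec * sz Y))
  bound_torus : ∀ v ∈ s, ∀ t μ ν x X, |b v t μ ν x X| ≤ A * Real.exp (-(dec * szt t X))
  supp_inf : ∀ v ∈ s, ∀ μ ν y Y, a v μ ν y Y ≠ 0 → l1 y ≤ M * sz Y
  supp_torus : ∀ v ∈ s, ∀ t μ ν x X, b v t μ ν x X ≠ 0 → l1 (windowMap d (side t) x) ≤ M * szt t X
  summable_inf : Summable (fun Y => Real.exp (-(dec / 2 * sz Y)))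
  tree_inf : ∑' Y, Real.exp (-(dec / 2 * sz Y)) ≤ K
  summable_torus : ∀ t, Summable (fun X => Real.exp (-(dec / 2 * szt t X)))
  tree_torus : ∀ t, ∑' X, Real.exp (-(dec / 2 * szt t X)) ≤ K
  stable : ∀ v ∈ s, ∀ t, ∃ φ : ↥{Y | sz Y < r t} ≃ ↥{X | szt t X < r t},
    ∀ (μ ν : Fin d) (x : Site d (side t)) (Y : ↥{Y | sz Y < r t}),
      b v t μ ν x (φ Y) = a v μ ν (windowMap d (side t) x) Y
  /-- (C-term): each finite-volume term is continuous in the parameter on `s` -/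
  cont_term : ∀ t μ ν (x : Site d (side t)) (X : κ t), ContinuousOn (fun v => b v t μ ν x X) s

section Family

variable {d : ℕ} {side : ℕ → ℕ} [∀ t, NeZero (side t)] {V : Type} [TopologicalSpace V] {s : Set V}
  {P : (t : ℕ) → V → Fin d → Fin d → Site d (side t) → ℝ} {A dec M K : ℝ} {r : ℕ → ℝ}

/-- The `ℤ^d` kernels of the family (total in `v`; meaningful for `v ∈ s`). [cite: Balaban1987RG1, (1.21) p.264] -/
def LocalizedFamily.locLimit (F : LocalizedFamily side s P A dec M K r) (v : V) : B12Beta.Kernel d :=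
  fun μ ν y => ∑' Y, F.a v μ ν y Y

/-- Projection: at each `v ∈ s` the family is a `LocalizedRep` of the torus kernels `t ↦ P t v`. [folklore] -/
def LocalizedFamily.rep (F : LocalizedFamily side s P A dec M K r) (v : V) (hv : v ∈ s) :
    LocalizedRep side (fun t => P t v) A dec M K r where
  ι := F.ι
  κ := F.κ
  sz := F.sz
  szt := F.szt
  a := F.a v
  b := F.b v
  A_nonneg := F.A_nonneg
  dec_pos := F.dec_pos
  M_pos := F.M_pos
  sz_nonneg := F.sz_nonneg
  szt_nonneg := F.szt_nonneg
  hasSum_torus := F.hasSum_torus v hv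
  bound_inf := F.bound_inf v hv
  bound_torus := F.bound_torus v hv
  supp_inf := F.supp_inf v hv
  supp_torus := F.supp_torus v hv
  summable_inf := F.summable_inf
  tree_inf := F.tree_inf
  summable_torus := F.summable_torus
  tree_torus := F.tree_torus
  stable := F.stable v hv

/-- The projection has the same `ℤ^d` kernel (definitional). [folklore] -/
theorem LocalizedFamily.rep_locLimit (F : LocalizedFamily side s P A dec M K r) (v : V) (hv : v ∈ s) :
    (F.rep v hv).locLimit = F.locLimit v := rfl

/-- **(C-fin) FROM (C-term)**: each finite-volume kernel entry `v ↦ P t v μ ν x` is continuous on `s` — Weierstrass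
M-test (`continuousOn_tsum`) with the `v`-uniform majorant `A e^{−(dec/2)·size}` summable by the torus tree leaf.
[folklore] -/
theorem LocalizedFamily.continuousOn_torus (F : LocalizedFamily side s P A dec M K r) (t : ℕ) (μ ν : Fin d)
    (x : Site d (side t)) : ContinuousOn (fun v => P t v μ ν x) s := by
  have hA := F.A_nonneg
  have hcont : ContinuousOn (fun v => ∑' X, F.b v t μ ν x X) s := by
    refine continuousOn_tsum (u := fun X => A * Real.exp (-(dec / 2 * F.szt t X))) (fun X => F.cont_term t μ ν x X)
      ((F.summable_torus t).mul_left A) ?_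
    intro X v hv
    rw [Real.norm_eq_abs]
    refine (F.bound_torus v hv t μ ν x X).trans (mul_le_mul_of_nonneg_left (Real.exp_le_exp.mpr ?_) hA)
    nlinarith [mul_nonneg F.dec_pos.le (F.szt_nonneg t X)]
  exact hcont.congr fun v hv => ((F.hasSum_torus v hv t μ ν x).tsum_eq).symm

/-- **(VR-u)**: the volume rate towards `locLimit v` with moduli and decay constant INDEPENDENT of `v ∈ s`.
[cite: Balaban1987RG1, (1.21) p.264] -/
theorem LocalizedFamily.volumeRate (F : LocalizedFamily side s P A dec M K r) :
    ∀ v ∈ s, VolumeRate side (fun t => P t v) (F.locLimit v)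
      (fun t => 2 * A * K * Real.exp (-(dec / 4 * r t))) (dec / (4 * M)) :=
  fun v hv => (F.rep v hv).volumeRate

/-- Existence of (1.21) on the whole parameter set (`r t → ∞`, `side t → ∞`). [cite: Balaban1987RG1, (1.21) p.264] -/
theorem LocalizedFamily.isInfiniteVolumeLimit (F : LocalizedFamily side s P A dec M K r)
    (hside : Tendsto side atTop atTop) (hr : Tendsto r atTop atTop) :
    ∀ v ∈ s, IsInfiniteVolumeLimit side (fun t => P t v) (F.locLimit v) :=
  fun v hv => (F.rep v hv).isInfiniteVolumeLimit hside hr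

/-- **(C-pt) for the limit kernels from ONE localized family**: every entry `v ↦ locLimit v μ ν y` is continuous on `s`
((C-fin) from (C-term), (VR-u) from (LOC) + tails, then `BetaContinuityVolume.continuousOn_lim_of_volumeRate`).
[cite: Balaban1987RG1, (1.21)–(1.22) p.264] -/
theorem LocalizedFamily.continuousOn_locLimit (F : LocalizedFamily side s P A dec M K r)
    (hside : Tendsto side atTop atTop) (hr : Tendsto r atTop atTop) (μ ν : Fin d) (y : Fin d → ℤ) :
    ContinuousOn (fun v => F.locLimit v μ ν y) s :=
  continuousOn_lim_of_volumeRate hside P F.locLimit F.volumeRate (tendsto_rate F.dec_pos hr) μ ν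
    (fun t x => F.continuousOn_torus t μ ν x) y

/-- (5.10)-shape decay of every limit kernel of the family with `v`-free constants — the shape of the hypothesis `hdec`
of `BetaContinuity.betaContH_of_kernel`. [cite: Balaban1987RG1, (5.10) p.293] -/
theorem LocalizedFamily.decay_locLimit (F : LocalizedFamily side s P A dec M K r) (μ ν : Fin d) :
    ∀ v ∈ s, Decay510 (F.locLimit v μ ν) (A * K) (dec / (2 * M)) :=
  fun v hv => (F.rep v hv).decay_locLimit μ ν

end Family

/-! ## 4. All scales: the clause `hcont` of `BetaContinuity.betaContH_of_chain` from localized families -/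

section Scales

variable {d : ℕ} {side : ℕ → ℕ → ℕ} [∀ k t, NeZero (side k t)]

/-- **(C-pt) over all scales from one localized family per scale**: the hypothesis `hcont` of
`BetaContinuity.betaContH_of_kernel` / `betaContH_of_chain` for any kernel family `P k v` identified on the boxes with
the families' `ℤ^d` kernels. [cite: Balaban1987RG1, (1.21)–(1.22) p.264] -/
theorem cpt_of_localizedFamily (hside : ∀ k, Tendsto (side k) atTop atTop) {γ : ℝ}
    (PT : (k t : ℕ) → (Fin (k + 1) → ℝ) → Fin d → Fin d → Site d (side k t) → ℝ)
    {A dec M K : ℕ → ℝ} {r : ℕ → ℕ → ℝ}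
    (F : ∀ k, LocalizedFamily (side k) (Box γ k) (PT k) (A k) (dec k) (M k) (K k) (r k))
    (hr : ∀ k, Tendsto (r k) atTop atTop) (P : (k : ℕ) → (Fin (k + 1) → ℝ) → B12Beta.Kernel d)
    (hP : ∀ k, ∀ v ∈ Box γ k, P k v = (F k).locLimit v) (μ ν : Fin d) :
    ∀ k (y : Fin d → ℤ), ContinuousOn (fun v => P k v μ ν y) (Box γ k) :=
  fun k y => ((F k).continuousOn_locLimit (hside k) (hr k) μ ν y).congr fun v hv => by simp only [hP k v hv]

/-- **(C) from a REMAINDER CHAIN (row an4) + one LOCALIZED FAMILY per scale for the torus remainder kernels**: the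
chain's limit kernels `R.P1 k v` are identified with the families' `ℤ^d` kernels on the boxes (`hP1`, an EQUATION — the
existence of the limit is a theorem here, `LocalizedFamily.isInfiniteVolumeLimit`, not an input); (C-pt) then holds by
§3 and `BetaContinuity.betaContH_of_chain` gives `BetaContH γ β`.  Inputs by name that no printed source supplies: the
leaves inside `R`; (LOC), the (1.18)-type bounds / tree leaves and (C-term) inside `F`.
[cite: Balaban1987RG1, (1.21)–(1.22) p.264; Balaban1988RG2Cluster, (2.41) p.21] -/
theorem betaContH_of_chain_localized (hside : ∀ k, Tendsto (side k) atTop atTop) {μ ν : Fin d} {β : HBeta}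
    {S : B12Beta.OneLoopSplit β} {γ : ℝ} {c : B13.Consts} {α₂ B₃ c₁ K₀ K₁ : ℝ}
    (R : Chain d μ ν S γ c α₂ B₃ c₁ K₀ K₁) (hs : ChainSigns c α₂ B₃ K₀)
    (PT : (k t : ℕ) → (Fin (k + 1) → ℝ) → Fin d → Fin d → Site d (side k t) → ℝ)
    {A dec M K : ℕ → ℝ} {r : ℕ → ℕ → ℝ}
    (F : ∀ k, LocalizedFamily (side k) (Box γ k) (PT k) (A k) (dec k) (M k) (K k) (r k))
    (hr : ∀ k, Tendsto (r k) atTop atTop) (hP1 : ∀ k, ∀ v ∈ Box γ k, R.P1 k v = (F k).locLimit v) :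
    BetaContH γ β :=
  betaContH_of_chain R hs (cpt_of_localizedFamily hside PT F hr R.P1 hP1 μ ν)

/-- The same with the identification made through pv25's limit predicate: if `R.P1 k v` is SOME pointwise
infinite-volume limit of the torus remainder kernels, it is the families' `ℤ^d` kernel by uniqueness.
[cite: Balaban1987RG1, (1.21)–(1.22) p.264] -/
theorem betaContH_of_chain_localized' (hside : ∀ k, Tendsto (side k) atTop atTop) {μ ν : Fin d} {β : HBeta}
    {S : B12Beta.OneLoopSplit β} {γ : ℝ} {c : B13.Consts} {α₂ B₃ c₁ K₀ K₁ : ℝ}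
    (R : Chain d μ ν S γ c α₂ B₃ c₁ K₀ K₁) (hs : ChainSigns c α₂ B₃ K₀)
    (PT : (k t : ℕ) → (Fin (k + 1) → ℝ) → Fin d → Fin d → Site d (side k t) → ℝ)
    {A dec M K : ℕ → ℝ} {r : ℕ → ℕ → ℝ}
    (F : ∀ k, LocalizedFamily (side k) (Box γ k) (PT k) (A k) (dec k) (M k) (K k) (r k))
    (hr : ∀ k, Tendsto (r k) atTop atTop)
    (hlim : ∀ k, ∀ v ∈ Box γ k, IsInfiniteVolumeLimit (side k) (fun t => PT k t v) (R.P1 k v)) :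
    BetaContH γ β :=
  betaContH_of_chain_localized hside R hs PT F hr
    fun k v hv => ((F k).rep v hv).eq_locLimit (hside k) (hr k) (hlim k v hv)

/-! ## 5. End to end with (C) supplied by localized families -/

/-- **END TO END, literal grade**: `B12.Thm2Printed C L` from (AF-0) on all scales, a remainder chain with the printed
signs, the ε₁-restriction, one localized family per scale for the torus remainder kernels (giving (C)), and the printed
upper bound (`BetaContinuity.thm2Printed_of_remainderChain_pt`).  NOT Theorem 2 unconditionally: (AF-0), the leaves
inside `R` and the fields of `F` are hypotheses no printed source supplies. [cite: Balaban1987RG1, Thm 2 (0.31) p.259] -/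
theorem thm2Printed_of_remainderChain_loc (hside : ∀ k, Tendsto (side k) atTop atTop) {C : B12.Construction}
    {β : HBeta} (hgen : ForwardGenerated C β) {μ ν : Fin d} (S : B12Beta.OneLoopSplit β) {γ₀ : ℝ} {c : B13.Consts}
    {α₂ B₃ c₁ K₀ K₁ : ℝ} (R : Chain d μ ν S γ₀ c α₂ B₃ c₁ K₀ K₁) (hs : ChainSigns c α₂ B₃ K₀) {L b β' : ℝ}
    (hL : 1 < L) (hγ₀ : 0 < γ₀) (hb : 0 < b) (hAF0 : ∀ k, 2 * b ≤ S.β0 k)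
    (hε₁ : c.ε₁ * remCoeff d c α₂ B₃ c₁ K₀ K₁ ≤ b)
    (PT : (k t : ℕ) → (Fin (k + 1) → ℝ) → Fin d → Fin d → Site d (side k t) → ℝ)
    {A dec M K : ℕ → ℝ} {r : ℕ → ℕ → ℝ}
    (F : ∀ k, LocalizedFamily (side k) (Box γ₀ k) (PT k) (A k) (dec k) (M k) (K k) (r k))
    (hr : ∀ k, Tendsto (r k) atTop atTop) (hP1 : ∀ k, ∀ v ∈ Box γ₀ k, R.P1 k v = (F k).locLimit v)
    (hup : BetaUpperH β' γ₀ β) : B12.Thm2Printed C L :=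
  thm2Printed_of_remainderChain_pt hgen S R hs hL hγ₀ hb hAF0 hε₁ (cpt_of_localizedFamily hside PT F hr R.P1 hP1 μ ν) hup

/-- **END-STATEMENT grade**: endpoint existence from a one-loop tail bound (AF-0 on a tail of scales), a remainder chain,
the ε₁-restriction, one localized family per scale for the torus remainder kernels, and the printed two-sided bound
(`BetaContinuity.endpointExistence_of_remainderChain_pt`). [cite: Balaban1987RG1, Thm 2 p.259 (first sentence)] -/
theorem endpointExistence_of_remainderChain_loc (hside : ∀ k, Tendsto (side k) atTop atTop) {C : B12.Construction}
    {β : HBeta} (hgen : ForwardGenerated C β) {μ ν : Fin d} (S : B12Beta.OneLoopSplit β) {γ₀ : ℝ} {c : B13.Consts}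
    {α₂ B₃ c₁ K₀ K₁ : ℝ} (R : Chain d μ ν S γ₀ c α₂ B₃ c₁ K₀ K₁) (hs : ChainSigns c α₂ B₃ K₀) {b β' : ℝ} {k₀ : ℕ}
    (hγ₀ : 0 < γ₀) (hb : 0 < b) (hβ' : 0 ≤ β') (hAF0 : ∀ k, k₀ ≤ k → 2 * b ≤ S.β0 k)
    (hε₁ : c.ε₁ * remCoeff d c α₂ B₃ c₁ K₀ K₁ ≤ b)
    (PT : (k t : ℕ) → (Fin (k + 1) → ℝ) → Fin d → Fin d → Site d (side k t) → ℝ)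
    {A dec M K : ℕ → ℝ} {r : ℕ → ℕ → ℝ}
    (F : ∀ k, LocalizedFamily (side k) (Box γ₀ k) (PT k) (A k) (dec k) (M k) (K k) (r k))
    (hr : ∀ k, Tendsto (r k) atTop atTop) (hP1 : ∀ k, ∀ v ∈ Box γ₀ k, R.P1 k v = (F k).locLimit v)
    (hlo : ∀ k, ∀ v ∈ Box γ₀ k, -β' ≤ β k v) (hup : BetaUpperH β' γ₀ β) : EndpointExistence C :=
  endpointExistence_of_remainderChain_pt hgen S R hs hγ₀ hb hβ' hAF0 hε₁
    (cpt_of_localizedFamily hside PT F hr R.P1 hP1 μ ν) hlo hup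

end Scales

/-! ## 6. Non-vacuity of the structure shapes (degenerate witnesses) -/

/-- The axioms of `LocalizedRep` are jointly satisfiable: empty index types represent the zero kernels (constants
`A = 0`, `dec = M = 1`, `K = 0`, any radii).  A DEGENERATE witness — it shows consistency of the shape, nothing about
Bałaban's kernels (a genuine instance needs the geometry of `B12Decay510`). [folklore] -/
example {d : ℕ} (side : ℕ → ℕ) [∀ t, NeZero (side t)] (r : ℕ → ℝ) :
    LocalizedRep side (fun t (_ : Fin d) (_ : Fin d) (_ : Site d (side t)) => (0 : ℝ)) 0 1 1 0 r where
  ι := Empty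
  κ := fun _ => Empty
  sz := fun Y => Y.elim
  szt := fun _ X => X.elim
  a := fun _ _ _ Y => Y.elim
  b := fun _ _ _ _ X => X.elim
  A_nonneg := le_rfl
  dec_pos := one_pos
  M_pos := one_pos
  sz_nonneg := fun Y => Y.elim
  szt_nonneg := fun _ X => X.elim
  hasSum_torus := fun _ _ _ _ => hasSum_empty
  bound_inf := fun _ _ _ Y => Y.elim
  bound_torus := fun _ _ _ _ X => X.elim
  supp_inf := fun _ _ _ Y => Y.elim
  supp_torus := fun _ _ _ _ X => X.elim
  summable_inf := summable_empty
  tree_inf := by rw [tsum_empty]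
  summable_torus := fun _ => summable_empty
  tree_torus := fun _ => by rw [tsum_empty]
  stable := fun _ => ⟨Equiv.equivOfIsEmpty _ _, fun _ _ _ Y => Y.1.elim⟩

/-- … and its `ℤ^d` kernel is the zero kernel, towards which the zero torus kernels converge at rate `0`. [folklore] -/
example {d : ℕ} (side : ℕ → ℕ) [∀ t, NeZero (side t)] :
    VolumeRate side (fun t (_ : Fin d) (_ : Fin d) (_ : Site d (side t)) => (0 : ℝ)) (fun _ _ _ => 0)
      (fun _ => 0) 1 := by
  intro t μ ν x
  simp

end

end Literature.MathematicalPhysics.QuantumFieldTheory.Balaban1983to89.Beta.LocalizedVolumeRate
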